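import Literature.Computability.FineGrained.CliqueETHReductionProgram
import Literature.Computability.FineGrained.SubcubicEquivalencesAPSP
import HarnessLib

/-!
# ETH-hardness of `k`-SUM (Pătraşcu–Williams 2010, Thm. 5.1 / Cor. 5.1): the machine-free core

Pătraşcu–Williams, *On the possibility of faster SAT algorithms*, SODA 2010, §5, prove: if `k`-SUM
on `N` numbers can be solved in time `N^{o(k)}`, then 3-SAT on `n` variables can be solved in time
`2^{o(n)}` (Cor. 5.1), i.e. ETH fails. Their reduction (proof of Thm. 5.1, pp. 1072–1073) sparsifies
the formula, converts each 3-clause into five *one-in-three* constraints by Schaefer's gadget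
`(x ∨ y ∨ z) ↦ R(x,a,d) ∧ R(y,b,d) ∧ R(a,b,e) ∧ R(c,d,f) ∧ R(z,c,False)` (six fresh variables per
clause), splits the variables into `k` blocks, and lists one number per (block, block assignment):
in a positional numeral system, `k` "block indicator" digits followed by one digit per constraint
counting the literals of that constraint made true by the block assignment; `k` numbers sum to the
all-ones target iff they take one assignment from each block and these satisfy every constraint
exactly once.

This file is the machine-free half of the formalisation of that reduction (the word-RAM program is
`KSumETHProgram.lean`, the run and the time analysis `KSumETHReduction.lean`):

* the gadget (`gadget`, `gposLit`, `posLit`) and its correctness (`gadgetOK_sound`,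
  `gadgetOK_wit`; `exists_forall_conSum_iff_satisfiable`: a width-`≤ 3` clause list is satisfiable
  iff some assignment of the extended variable set satisfies every constraint exactly once);
* the numbers (`cnt`, `high`, `val`, `yval`), the target `Xt`, the dummy `D0` and the list
  `ksumList φ K` handed to the `K`-SUM algorithm, in the zero-sum normal form of the problem zoo
  (`kSUM K`: "`K` entries at distinct positions summing to `0`", entries in `[-N^K, N^K]`): the
  printed "sum of `K` values equal to `X`" is turned into a zero sum by `y = (K+1)(K·x − X)`, and the
  list is padded with copies of `D0 ≡ 1 (mod K+1)`, `D0 > |y|`, so that the range promise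
  `|entry| ≤ N^K` holds (`hasBoundedEntries_ksumList`) while no dummy can take part in a zero sum;
* **the equivalence** `hasKSum_ksumList_iff`: `HasKSum K (ksumList φ K) ↔ φ.Satisfiable`
  (`K ≥ 2`, width `≤ 3`) — block indicators in base `K + 1` below, constraint digits in base `4`
  above (`(K+1)^K · 4^j`), uniqueness of positional representations (`digits_unique`);
* the word encoding seen by the `K`-SUM program: `encodeInt (yval …) = ycode …`,
  `inputWidth (encodeIntList (ksumList φ K)) = Nat.size (max N (2 D0))`.

Design note. Print uses one base `d + 1` for all digits; with the zoo's range `[-N^K, N^K]` and the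
liberal hypothesis "exponent `g(k)` with `g(k)/k → 0`" a uniform base `Θ(K)` would cost a factor
`log K` in the bit length that `g(k)/k → 0` cannot absorb, whence the mixed radix (indicator digits
need base `> K`, constraint digits only base `> 3`). Clauses of width `< 3` are padded with the
constant `False` (the gadget is correct pointwise in the truth values of `x, y, z`; the empty clause
becomes an unsatisfiable gadget).

## References

* M. Pătraşcu, R. Williams, *On the possibility of faster SAT algorithms*, Proc. SODA 2010,
  1065–1075, §5: Thm. 5.1, Cor. 5.1 and the proof of Thm. 5.1 (pp. 1072–1073).
* T. J. Schaefer, *The complexity of satisfiability problems*, STOC 1978 (one-in-three SAT).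
-/

namespace Literature.Computability.FineGrained

open Cryptography Complexity Finset

namespace KSumRed

/-! ### Schaefer's gadget -/

/-- The content of position `e < 3` of constraint `r < 5` of the gadget of one clause:
`some (inl l)` = literal slot `l` of the clause, `some (inr f)` = fresh variable `f < 6`
(`a,b,c,d,e,f ↦ 0,…,5`, always positive), `none` = the constant `False`. The five constraints are
`R(x,a,d)`, `R(y,b,d)`, `R(a,b,e)`, `R(c,d,f)`, `R(z,c,False)` (Pătraşcu–Williams 2010, proof of
Thm. 5.1). [cite: PatrascuWilliams2010, proof of Thm. 5.1] -/
def gadget : ℕ → ℕ → Option (ℕ ⊕ ℕ)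
  | 0, 0 => some (.inl 0)
  | 0, 1 => some (.inr 0)
  | 0, 2 => some (.inr 3)
  | 1, 0 => some (.inl 1)
  | 1, 1 => some (.inr 1)
  | 1, 2 => some (.inr 3)
  | 2, 0 => some (.inr 0)
  | 2, 1 => some (.inr 1)
  | 2, 2 => some (.inr 4)
  | 3, 0 => some (.inr 2)
  | 3, 1 => some (.inr 3)
  | 3, 2 => some (.inr 5)
  | 4, 0 => some (.inl 2)
  | 4, 1 => some (.inr 2)
  | _, _ => none

/-- Exactly one of three Booleans holds (the relation `R` of one-in-three SAT). [folklore] -/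
def R3 (u v w : Bool) : Bool :=
  u.toNat + v.toNat + w.toNat == 1

/-- The gadget of a clause with literal values `x, y, z` and fresh values `w : Fin 6 → Bool`
holds: all five one-in-three constraints are satisfied. [cite: PatrascuWilliams2010, proof of
Thm. 5.1] -/
def gadgetOK (x y z : Bool) (w : Fin 6 → Bool) : Bool :=
  R3 x (w 0) (w 3) && R3 y (w 1) (w 3) && R3 (w 0) (w 1) (w 4) && R3 (w 2) (w 3) (w 5) &&
    R3 z (w 2) false

/-- Witnesses for the fresh variables `a, …, f` of a satisfied clause. [folklore] -/
def wit (x y z : Bool) : Fin 6 → Bool :=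
  match x, y, z with
  | true, false, false => ![false, true, true, false, false, false]
  | false, true, false => ![true, false, true, false, false, false]
  | false, false, true => ![false, false, false, true, true, false]
  | true, true, false => ![false, false, true, false, true, false]
  | true, false, true => ![false, true, false, false, false, true]
  | false, true, true => ![true, false, false, false, false, true]
  | true, true, true => ![false, false, false, false, true, true]
  | false, false, false => ![false, false, false, false, false, false]

/-- **Soundness of the gadget**: if the five constraints hold then the clause holds. [cite:
PatrascuWilliams2010, proof of Thm. 5.1] -/
theorem gadgetOK_sound (x y z : Bool) (w : Fin 6 → Bool) (h : gadgetOK x y z w = true) :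
    (x || y || z) = true := by
  revert x y z w h
  decide

/-- **Completeness of the gadget**: a satisfied clause extends to the fresh variables. [cite:
PatrascuWilliams2010, proof of Thm. 5.1] -/
theorem gadgetOK_wit (x y z : Bool) (h : (x || y || z) = true) : gadgetOK x y z (wit x y z) = true := by
  revert x y z h
  decide


/-! ### Gadget positions of a clause list -/

/-- The literal at position `e` of constraint `r` of the gadget of clause `q` of `φ`, over the
extended variable set (fresh variable `f` of clause `q` is `numVars φ + 6 q + f`); `none` for the
constant `False`, for a missing literal slot, and past the last clause. [folklore] -/
def gposLit (φ : CNF ℕ) (q r e : ℕ) : Option (Literal ℕ) :=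
  match gadget r e with
  | some (.inl l) => CliqueRed.litAt φ q l
  | some (.inr f) => some (φ.numVars + 6 * q + f, true)
  | none => none

/-- The literal at position `e < 3` of constraint `j` (constraint `j % 5` of clause `j / 5`).
[folklore] -/
def posLit (φ : CNF ℕ) (j e : ℕ) : Option (Literal ℕ) :=
  gposLit φ (j / 5) (j % 5) e

/-- The value (`0`/`1`) of position `(j, e)` under an assignment of the extended variables.
[folklore] -/
def posVal (φ : CNF ℕ) (σ : ℕ → Bool) (j e : ℕ) : ℕ :=
  match posLit φ j e with
  | some l => (σ l.1 == l.2).toNat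
  | none => 0

/-- The number of true positions of constraint `j` under `σ`; the constraint holds iff it is `1`.
[folklore] -/
def conSum (φ : CNF ℕ) (σ : ℕ → Bool) (j : ℕ) : ℕ :=
  posVal φ σ j 0 + posVal φ σ j 1 + posVal φ σ j 2

/-- The value of literal slot `l` of clause `q` under `σ` (`false` for a missing slot). [folklore] -/
def slotVal (φ : CNF ℕ) (σ : ℕ → Bool) (q l : ℕ) : Bool :=
  match CliqueRed.litAt φ q l with
  | some lit => σ lit.1 == lit.2
  | none => false

/-- The values of the six fresh variables of clause `q` under `σ`. [folklore] -/
def freshVal (φ : CNF ℕ) (σ : ℕ → Bool) (q : ℕ) : Fin 6 → Bool :=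
  fun f => σ (φ.numVars + 6 * q + f)

/-- `Bool.toNat` of a `beq` against `true`. [folklore] -/
theorem toNat_beq_true (b : Bool) : (b == true).toNat = b.toNat := by cases b <;> rfl

/-- The arms of `gadget` with a fresh variable. [folklore] -/
theorem gadget_eq_inr {r e f : ℕ} (h : gadget r e = some (.inr f)) : r < 5 ∧ e < 3 ∧ f < 6 := by
  unfold gadget at h
  split at h <;> simp at h <;> omega

/-- The arms of `gadget` with a literal slot. [folklore] -/
theorem gadget_eq_inl {r e l : ℕ} (h : gadget r e = some (.inl l)) : r < 5 ∧ e < 3 ∧ l < 3 := by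
  unfold gadget at h
  split at h <;> simp at h <;> omega

/-- Constraint `5 q + r` is constraint `r` of clause `q`. [folklore] -/
theorem posLit_eq (φ : CNF ℕ) (q : ℕ) {r : ℕ} (e : ℕ) (hr : r < 5) :
    posLit φ (5 * q + r) e = gposLit φ q r e := by
  unfold posLit
  rw [Nat.mul_add_div (by norm_num), Nat.div_eq_of_lt hr, Nat.add_zero, Nat.mul_add_mod,
    Nat.mod_eq_of_lt hr]

/-- `gposLit` at a literal slot. [folklore] -/
theorem gposLit_of_inl {φ : CNF ℕ} {q r e l : ℕ} (h : gadget r e = some (.inl l)) :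
    gposLit φ q r e = CliqueRed.litAt φ q l := by
  simp only [gposLit, h]

/-- `gposLit` at a fresh-variable slot. [folklore] -/
theorem gposLit_of_inr {φ : CNF ℕ} {q r e f : ℕ} (h : gadget r e = some (.inr f)) :
    gposLit φ q r e = some (φ.numVars + 6 * q + f, true) := by
  simp only [gposLit, h]

/-- `gposLit` at a `False` slot. [folklore] -/
theorem gposLit_of_none {φ : CNF ℕ} {q r e : ℕ} (h : gadget r e = none) : gposLit φ q r e = none := by
  simp only [gposLit, h]

/-- `posVal` at a literal slot of the gadget. [folklore] -/
theorem posVal_of_gadget_inl {φ : CNF ℕ} {σ : ℕ → Bool} {q r e l : ℕ} (hr : r < 5)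
    (h : gadget r e = some (.inl l)) : posVal φ σ (5 * q + r) e = (slotVal φ σ q l).toNat := by
  rw [posVal, posLit_eq φ q e hr, gposLit_of_inl h, slotVal]
  cases CliqueRed.litAt φ q l <;> rfl

/-- `posVal` at a fresh-variable slot of the gadget. [folklore] -/
theorem posVal_of_gadget_inr {φ : CNF ℕ} {σ : ℕ → Bool} {q r e : ℕ} (f : Fin 6) (hr : r < 5)
    (h : gadget r e = some (.inr f.1)) :
    posVal φ σ (5 * q + r) e = (freshVal φ σ q f).toNat := by
  rw [posVal, posLit_eq φ q e hr, gposLit_of_inr h, freshVal]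
  exact toNat_beq_true _

/-- `posVal` at a `False` slot of the gadget. [folklore] -/
theorem posVal_of_gadget_none {φ : CNF ℕ} {σ : ℕ → Bool} {q r e : ℕ} (hr : r < 5)
    (h : gadget r e = none) : posVal φ σ (5 * q + r) e = 0 := by
  rw [posVal, posLit_eq φ q e hr, gposLit_of_none h]

/-- `R3` as a sum of `toNat`s. [folklore] -/
theorem R3_eq_true_iff (u v w : Bool) : R3 u v w = true ↔ u.toNat + v.toNat + w.toNat = 1 := by
  simp [R3]

/-- **The five constraints of clause `q` hold under `σ` iff the gadget holds** on the slot values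
and the fresh values. [folklore] -/
theorem forall_conSum_eq_one_iff (φ : CNF ℕ) (σ : ℕ → Bool) (q : ℕ) :
    (∀ r, r < 5 → conSum φ σ (5 * q + r) = 1) ↔
      gadgetOK (slotVal φ σ q 0) (slotVal φ σ q 1) (slotVal φ σ q 2) (freshVal φ σ q) = true := by
  have h0 : conSum φ σ (5 * q + 0) = (slotVal φ σ q 0).toNat + (freshVal φ σ q 0).toNat +
      (freshVal φ σ q 3).toNat := by
    unfold conSum
    rw [posVal_of_gadget_inl (l := 0) (by norm_num) rfl,
      posVal_of_gadget_inr 0 (by norm_num) rfl,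
      posVal_of_gadget_inr 3 (by norm_num) rfl]
  have h1 : conSum φ σ (5 * q + 1) = (slotVal φ σ q 1).toNat + (freshVal φ σ q 1).toNat +
      (freshVal φ σ q 3).toNat := by
    unfold conSum
    rw [posVal_of_gadget_inl (l := 1) (by norm_num) rfl,
      posVal_of_gadget_inr 1 (by norm_num) rfl,
      posVal_of_gadget_inr 3 (by norm_num) rfl]
  have h2 : conSum φ σ (5 * q + 2) = (freshVal φ σ q 0).toNat + (freshVal φ σ q 1).toNat +
      (freshVal φ σ q 4).toNat := by
    unfold conSum
    rw [posVal_of_gadget_inr 0 (by norm_num) rfl,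
      posVal_of_gadget_inr 1 (by norm_num) rfl,
      posVal_of_gadget_inr 4 (by norm_num) rfl]
  have h3 : conSum φ σ (5 * q + 3) = (freshVal φ σ q 2).toNat + (freshVal φ σ q 3).toNat +
      (freshVal φ σ q 5).toNat := by
    unfold conSum
    rw [posVal_of_gadget_inr 2 (by norm_num) rfl,
      posVal_of_gadget_inr 3 (by norm_num) rfl,
      posVal_of_gadget_inr 5 (by norm_num) rfl]
  have h4 : conSum φ σ (5 * q + 4) = (slotVal φ σ q 2).toNat + (freshVal φ σ q 2).toNat + 0 := by
    unfold conSum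
    rw [posVal_of_gadget_inl (l := 2) (by norm_num) rfl,
      posVal_of_gadget_inr 2 (by norm_num) rfl,
      posVal_of_gadget_none (by norm_num) rfl]
  constructor
  · intro h
    have e0 := h 0 (by norm_num); have e1 := h 1 (by norm_num); have e2 := h 2 (by norm_num)
    have e3 := h 3 (by norm_num); have e4 := h 4 (by norm_num)
    rw [h0] at e0; rw [h1] at e1; rw [h2] at e2; rw [h3] at e3; rw [h4] at e4
    simp only [gadgetOK, Bool.and_eq_true, R3_eq_true_iff, Bool.toNat_false]
    exact ⟨⟨⟨⟨e0, e1⟩, e2⟩, e3⟩, e4⟩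
  · intro h r hr
    simp only [gadgetOK, Bool.and_eq_true, R3_eq_true_iff, Bool.toNat_false] at h
    obtain ⟨⟨⟨⟨e0, e1⟩, e2⟩, e3⟩, e4⟩ := h
    interval_cases r
    · rw [h0]; exact e0
    · rw [h1]; exact e1
    · rw [h2]; exact e2
    · rw [h3]; exact e3
    · rw [h4]; exact e4

/-! ### One-in-three satisfiability of the gadget formula versus satisfiability of `φ` -/

/-- A true literal slot is a true literal of the clause. [folklore] -/
theorem exists_mem_of_slotVal {φ : CNF ℕ} {σ : ℕ → Bool} {q l : ℕ} (hq : q < φ.length)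
    (h : slotVal φ σ q l = true) : ∃ lit ∈ φ[q], Literal.eval σ lit = true := by
  unfold slotVal at h
  cases hl : CliqueRed.litAt φ q l with
  | none => rw [hl] at h; exact absurd h (by simp)
  | some lit =>
    rw [hl] at h
    refine ⟨lit, ?_, h⟩
    unfold CliqueRed.litAt at hl
    rw [List.getElem?_eq_getElem hq, Option.bind_some] at hl
    exact List.mem_of_getElem? hl

/-- **Soundness**: an assignment satisfying every constraint exactly once satisfies the width-`≤ 3`
clause list. [cite: PatrascuWilliams2010, proof of Thm. 5.1] -/
theorem eval_of_forall_conSum {φ : CNF ℕ} {σ : ℕ → Bool}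
    (h : ∀ j, j < 5 * φ.length → conSum φ σ j = 1) : φ.eval σ = true := by
  rw [CNF.eval_eq_true_iff]
  intro c hc
  obtain ⟨q, hq, rfl⟩ := List.getElem_of_mem hc
  have hg : gadgetOK (slotVal φ σ q 0) (slotVal φ σ q 1) (slotVal φ σ q 2) (freshVal φ σ q) = true :=
    (forall_conSum_eq_one_iff φ σ q).1 fun r hr => h _ (by omega)
  have hs := gadgetOK_sound _ _ _ _ hg
  simp only [Bool.or_eq_true] at hs
  unfold Clause.eval
  rw [List.any_eq_true]
  rcases hs with (hs | hs) | hs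
  · exact exists_mem_of_slotVal hq hs
  · exact exists_mem_of_slotVal hq hs
  · exact exists_mem_of_slotVal hq hs

/-- The extension of an assignment of `φ` to the fresh variables by the gadget witnesses.
[folklore] -/
def extend (φ : CNF ℕ) (σ : ℕ → Bool) (v : ℕ) : Bool :=
  if v < φ.numVars then σ v
  else wit (slotVal φ σ ((v - φ.numVars) / 6) 0) (slotVal φ σ ((v - φ.numVars) / 6) 1)
    (slotVal φ σ ((v - φ.numVars) / 6) 2) ⟨(v - φ.numVars) % 6, Nat.mod_lt _ (by norm_num)⟩

/-- `extend` agrees with `σ` on the variables of `φ`. [folklore] -/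
theorem extend_of_lt {φ : CNF ℕ} (σ : ℕ → Bool) {v : ℕ} (hv : v < φ.numVars) : extend φ σ v = σ v := by
  unfold extend; rw [if_pos hv]

/-- The slot values are unchanged by `extend` (slots carry variables of `φ`). [folklore] -/
theorem slotVal_extend (φ : CNF ℕ) (σ : ℕ → Bool) (q l : ℕ) :
    slotVal φ (extend φ σ) q l = slotVal φ σ q l := by
  unfold slotVal
  cases hl : CliqueRed.litAt φ q l with
  | none => rfl
  | some lit =>
    simp only
    have hmem : ∃ c ∈ φ, lit ∈ c := by
      unfold CliqueRed.litAt at hl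
      cases hc : φ[q]? with
      | none => rw [hc] at hl; simp at hl
      | some cl =>
        rw [hc, Option.bind_some] at hl
        exact ⟨cl, List.mem_of_getElem? hc, List.mem_of_getElem? hl⟩
    obtain ⟨c, hc, hlit⟩ := hmem
    rw [extend_of_lt σ (CliqueRed.lt_numVars_of_mem hc hlit)]

/-- The fresh values of `extend` are the witnesses. [folklore] -/
theorem freshVal_extend (φ : CNF ℕ) (σ : ℕ → Bool) (q : ℕ) :
    freshVal φ (extend φ σ) q =
      wit (slotVal φ σ q 0) (slotVal φ σ q 1) (slotVal φ σ q 2) := by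
  funext f
  unfold freshVal extend
  rw [if_neg (by omega)]
  have h1 : (φ.numVars + 6 * q + f - φ.numVars) / 6 = q := by
    rw [show φ.numVars + 6 * q + f - φ.numVars = 6 * q + f by omega, Nat.mul_add_div (by norm_num),
      Nat.div_eq_of_lt f.2, Nat.add_zero]
  have h2 : (φ.numVars + 6 * q + f - φ.numVars) % 6 = f := by
    rw [show φ.numVars + 6 * q + f - φ.numVars = 6 * q + f by omega, Nat.mul_add_mod,
      Nat.mod_eq_of_lt f.2]
  simp only [h1, h2]

/-- A satisfied clause has a true slot among its first three slots (width `≤ 3`). [folklore] -/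
theorem slotVal_or_of_eval {φ : CNF ℕ} (hw : φ.IsWidthLE 3) {σ : ℕ → Bool} {q : ℕ} (hq : q < φ.length)
    (h : Clause.eval σ φ[q] = true) :
    (slotVal φ σ q 0 || slotVal φ σ q 1 || slotVal φ σ q 2) = true := by
  unfold Clause.eval at h
  rw [List.any_eq_true] at h
  obtain ⟨lit, hlit, hev⟩ := h
  obtain ⟨l, hl, rfl⟩ := List.getElem_of_mem hlit
  have hl3 : l < 3 := lt_of_lt_of_le hl (hw _ (List.getElem_mem hq))
  have hsv : slotVal φ σ q l = true := by
    unfold slotVal; rw [CliqueRed.litAt_of_lt hq hl]; exact hev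
  simp only [Bool.or_eq_true]
  interval_cases l
  · exact Or.inl (Or.inl hsv)
  · exact Or.inl (Or.inr hsv)
  · exact Or.inr hsv

/-- **Completeness**: a satisfying assignment of the width-`≤ 3` clause list extends to one
satisfying every constraint exactly once. [cite: PatrascuWilliams2010, proof of Thm. 5.1] -/
theorem forall_conSum_extend {φ : CNF ℕ} (hw : φ.IsWidthLE 3) {σ : ℕ → Bool} (h : φ.eval σ = true)
    (j : ℕ) (hj : j < 5 * φ.length) : conSum φ (extend φ σ) j = 1 := by
  have hq : j / 5 < φ.length := by omega
  have key : ∀ r, r < 5 → conSum φ (extend φ σ) (5 * (j / 5) + r) = 1 := by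
    rw [forall_conSum_eq_one_iff, slotVal_extend, slotVal_extend, slotVal_extend, freshVal_extend]
    exact gadgetOK_wit _ _ _ (slotVal_or_of_eval hw hq ((CNF.eval_eq_true_iff φ σ).1 h _
      (List.getElem_mem hq)))
  have := key (j % 5) (Nat.mod_lt _ (by norm_num))
  rwa [Nat.div_add_mod] at this

/-- **The gadget formula is one-in-three satisfiable iff `φ` is satisfiable** (width `≤ 3`).
[cite: PatrascuWilliams2010, proof of Thm. 5.1] -/
theorem exists_forall_conSum_iff_satisfiable {φ : CNF ℕ} (hw : φ.IsWidthLE 3) :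
    (∃ σ : ℕ → Bool, ∀ j, j < 5 * φ.length → conSum φ σ j = 1) ↔ φ.Satisfiable :=
  ⟨fun ⟨_, hσ⟩ => ⟨_, eval_of_forall_conSum hσ⟩,
    fun ⟨σ, hσ⟩ => ⟨extend φ σ, forall_conSum_extend hw hσ⟩⟩

/-- Every variable at a gadget position is below `numVars φ + 6 · |φ|`. [folklore] -/
theorem posLit_fst_lt {φ : CNF ℕ} {j e : ℕ} {lit : Literal ℕ} (hj : j < 5 * φ.length)
    (h : posLit φ j e = some lit) : lit.1 < φ.numVars + 6 * φ.length := by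
  unfold posLit gposLit at h
  split at h
  · rename_i l _
    unfold CliqueRed.litAt at h
    cases hc : φ[j / 5]? with
    | none => rw [hc] at h; simp at h
    | some cl =>
      rw [hc, Option.bind_some] at h
      have := CliqueRed.lt_numVars_of_mem (List.mem_of_getElem? hc) (List.mem_of_getElem? h)
      omega
  · rename_i f hg
    have hf : f < 6 := (gadget_eq_inr hg).2.2
    simp only [Option.some.injEq] at h
    rw [← h]
    dsimp only
    omega
  · simp at h

/-- `conSum` depends only on the values of `σ` below `numVars φ + 6 |φ|`. [folklore] -/
theorem conSum_congr {φ : CNF ℕ} {σ τ : ℕ → Bool} (h : ∀ v, v < φ.numVars + 6 * φ.length → σ v = τ v)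
    {j : ℕ} (hj : j < 5 * φ.length) : conSum φ σ j = conSum φ τ j := by
  have hp : ∀ e, posVal φ σ j e = posVal φ τ j e := fun e => by
    unfold posVal
    cases hl : posLit φ j e with
    | none => rfl
    | some lit => simp only; rw [h _ (posLit_fst_lt hj hl)]
  unfold conSum; rw [hp, hp, hp]


/-! ### Blocks of variables, block assignments, and the digits they contribute -/

/-- The bit "position `(j, e)` carries a literal whose variable lies in block `i` (variables
`i s, …, i s + s - 1`) and is made true by the block assignment `μ` (bit `v - i s` of `μ`)".
[cite: PatrascuWilliams2010, proof of Thm. 5.1] -/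
def posBit (φ : CNF ℕ) (s i μ j e : ℕ) : Bool :=
  match posLit φ j e with
  | some l => (i * s ≤ l.1) && (l.1 < i * s + s) && (μ.testBit (l.1 - i * s) == l.2)
  | none => false

/-- The digit of constraint `j` contributed by block `i` under the block assignment `μ`: the
number of positions of the constraint made true by it ("the number of variables in this assignment
that are satisfying each particular clause"). [cite: PatrascuWilliams2010, proof of Thm. 5.1] -/
def cnt (φ : CNF ℕ) (s i μ j : ℕ) : ℕ :=
  (posBit φ s i μ j 0).toNat + (posBit φ s i μ j 1).toNat + (posBit φ s i μ j 2).toNat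

/-- A digit is at most `3`. [folklore] -/
theorem cnt_le (φ : CNF ℕ) (s i μ j : ℕ) : cnt φ s i μ j ≤ 3 := by
  unfold cnt
  have h := fun e => Bool.toNat_le (posBit φ s i μ j e)
  have h0 := h 0; have h1 := h 1; have h2 := h 2
  omega

/-! ### The parameters of the instance -/

/-- The number of variables of the gadget formula: `n + 6 m`. [folklore] -/
def nAll (φ : CNF ℕ) : ℕ := φ.numVars + 6 * φ.length

/-- The block size `s = ⌈(n + 6m) / K⌉`. [folklore] -/
def bs (φ : CNF ℕ) (K : ℕ) : ℕ := blockLen (nAll φ) K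

/-- The number of block assignments `2^s`. [folklore] -/
def nMask (φ : CNF ℕ) (K : ℕ) : ℕ := 2 ^ bs φ K

/-- The exponent `t = ⌈10 m / K⌉` of the padding. [folklore] -/
def bt (φ : CNF ℕ) (K : ℕ) : ℕ := blockLen (10 * φ.length) K

/-- The number of dummies `P = 4 (K+1)² 2^t` (so that `P^K ≥ D0`). [folklore] -/
def P (φ : CNF ℕ) (K : ℕ) : ℕ := 4 * (K + 1) ^ 2 * 2 ^ bt φ K

/-- The length of the list: `N = K · 2^s + P`. [folklore] -/
def N (φ : CNF ℕ) (K : ℕ) : ℕ := K * nMask φ K + P φ K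

/-- The weight `(K+1)^K` of the lowest constraint digit. [folklore] -/
def BK (K : ℕ) : ℕ := (K + 1) ^ K

/-- `4^{5m}`: one above the largest constraint part. [folklore] -/
def F (φ : CNF ℕ) : ℕ := 4 ^ (5 * φ.length)

/-- The indicator part of the target: all indicator digits `1`. [folklore] -/
def lowX (K : ℕ) : ℕ := ∑ i ∈ range K, (K + 1) ^ i

/-- The constraint part of the target: all constraint digits `1`. [folklore] -/
def highX (φ : CNF ℕ) : ℕ := ∑ j ∈ range (5 * φ.length), 4 ^ j

/-- **The target** `X`: the number all of whose digits are `1`. [cite: PatrascuWilliams2010,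
proof of Thm. 5.1] -/
def Xt (φ : CNF ℕ) (K : ℕ) : ℕ := lowX K + BK K * highX φ

/-- The range bound `R = (K+1)^K · 4^{5m}` of the numbers and the target. [folklore] -/
def R (φ : CNF ℕ) (K : ℕ) : ℕ := BK K * F φ

/-- **The dummy** `D0 = (K+1) K R + 1`: congruent to `1` modulo `K + 1` and larger than every
`|y|`. [folklore] -/
def D0 (φ : CNF ℕ) (K : ℕ) : ℕ := (K + 1) * K * R φ K + 1

/-- The constraint part of the number of `(i, μ)`. [cite: PatrascuWilliams2010, proof of Thm. 5.1] -/
def high (φ : CNF ℕ) (K i μ : ℕ) : ℕ := ∑ j ∈ range (5 * φ.length), cnt φ (bs φ K) i μ j * 4 ^ j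

/-- **The number of block `i` and block assignment `μ`**: indicator digit `i` and the constraint
digits. [cite: PatrascuWilliams2010, proof of Thm. 5.1] -/
def val (φ : CNF ℕ) (K i μ : ℕ) : ℕ := (K + 1) ^ i + BK K * high φ K i μ

/-- **The list entry of `(i, μ)`** in zero-sum normal form: `y = (K+1) (K · val − X)`.
[cite: PatrascuWilliams2010, proof of Thm. 5.1 ("adding −X/d to all numbers")] -/
def yval (φ : CNF ℕ) (K i μ : ℕ) : ℤ :=
  ((K + 1 : ℕ) : ℤ) * ((K : ℤ) * (val φ K i μ : ℤ) - (Xt φ K : ℤ))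

/-- Entry `ι` of the list: the numbers of the pairs `(i, μ) = (ι / 2^s, ι % 2^s)` for
`ι < K 2^s`, then the dummies. [folklore] -/
def entry (φ : CNF ℕ) (K ι : ℕ) : ℤ :=
  if ι < K * nMask φ K then yval φ K (ι / nMask φ K) (ι % nMask φ K) else (D0 φ K : ℤ)

/-- **The `K`-SUM instance** built from `φ`. [cite: PatrascuWilliams2010, proof of Thm. 5.1] -/
def ksumList (φ : CNF ℕ) (K : ℕ) : List ℤ := (List.range (N φ K)).map (entry φ K)

/-- The list has length `N`. [folklore] -/
@[simp] theorem length_ksumList (φ : CNF ℕ) (K : ℕ) : (ksumList φ K).length = N φ K := by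
  simp [ksumList]

/-- The entries of the list. [folklore] -/
theorem getElem_ksumList (φ : CNF ℕ) (K : ℕ) {ι : ℕ} (h : ι < (ksumList φ K).length) :
    (ksumList φ K)[ι] = entry φ K ι := by
  simp [ksumList]

/-! ### Geometric sums and the sizes of the parts -/

/-- `B · ∑_{i<M} (B+1)^i + 1 = (B+1)^M`. [folklore] -/
theorem geom_sum_mul_add_one (B M : ℕ) : B * ∑ i ∈ range M, (B + 1) ^ i + 1 = (B + 1) ^ M := by
  induction M with
  | zero => simp
  | succ M ih =>
    rw [sum_range_succ, Nat.mul_add, pow_succ]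
    calc B * ∑ i ∈ range M, (B + 1) ^ i + B * (B + 1) ^ M + 1
        = (B * ∑ i ∈ range M, (B + 1) ^ i + 1) + B * (B + 1) ^ M := by ring
      _ = (B + 1) ^ M + B * (B + 1) ^ M := by rw [ih]
      _ = (B + 1) ^ M * (B + 1) := by ring

/-- `K · lowX + 1 = (K+1)^K`. [folklore] -/
theorem K_mul_lowX_add_one (K : ℕ) : K * lowX K + 1 = BK K :=
  geom_sum_mul_add_one K K

/-- `3 · highX + 1 = 4^{5m}`. [folklore] -/
theorem three_mul_highX_add_one (φ : CNF ℕ) : 3 * highX φ + 1 = F φ := by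
  have := geom_sum_mul_add_one 3 (5 * φ.length)
  simpa [highX, F] using this

/-- A number with digits `≤ 3` in base `4` is below `4^M`: `3 · high + 1 ≤ … `; here
`high ≤ highX · 3`, i.e. `high + 1 ≤ 4^{5m}`. [folklore] -/
theorem high_lt_F (φ : CNF ℕ) (K i μ : ℕ) : high φ K i μ < F φ := by
  have h : high φ K i μ ≤ 3 * highX φ := by
    unfold high highX
    rw [mul_sum]
    exact sum_le_sum fun j _ => Nat.mul_le_mul_right _ (cnt_le φ _ i μ j)
  have := three_mul_highX_add_one φ
  omega

/-- `1 ≤ BK`. [folklore] -/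
theorem one_le_BK (K : ℕ) : 1 ≤ BK K := Nat.one_le_pow _ _ (by omega)

/-- `1 ≤ F`. [folklore] -/
theorem one_le_F (φ : CNF ℕ) : 1 ≤ F φ := Nat.one_le_pow _ _ (by omega)

/-- Indicator digits are below `BK`: `(K+1)^i < (K+1)^K` for `i < K`. [folklore] -/
theorem pow_lt_BK {K i : ℕ} (hi : i < K) : (K + 1) ^ i < BK K :=
  Nat.pow_lt_pow_right (by omega) hi

/-- **The numbers lie in `[1, R)`.** [folklore] -/
theorem val_lt_R (φ : CNF ℕ) {K i : ℕ} (hi : i < K) (μ : ℕ) : val φ K i μ < R φ K := by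
  have h1 := pow_lt_BK hi
  have h2 := high_lt_F φ K i μ
  have h3 : BK K * high φ K i μ + BK K ≤ BK K * F φ := by
    rw [← Nat.mul_succ]; exact Nat.mul_le_mul_left _ h2
  unfold val R; omega

/-- The numbers are positive. [folklore] -/
theorem one_le_val (φ : CNF ℕ) (K i μ : ℕ) : 1 ≤ val φ K i μ :=
  le_add_right (Nat.one_le_pow _ _ (by omega))

/-- `lowX < BK` (for `K ≥ 1`). [folklore] -/
theorem lowX_lt_BK {K : ℕ} (hK : 1 ≤ K) : lowX K < BK K := by
  have := K_mul_lowX_add_one K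
  have : lowX K ≤ K * lowX K := Nat.le_mul_of_pos_left _ hK
  omega

/-- `highX < F`. [folklore] -/
theorem highX_lt_F (φ : CNF ℕ) : highX φ < F φ := by
  have := three_mul_highX_add_one φ; omega

/-- **The target lies in `[1, R)`** (for `K ≥ 1`). [folklore] -/
theorem Xt_lt_R (φ : CNF ℕ) {K : ℕ} (hK : 1 ≤ K) : Xt φ K < R φ K := by
  have h1 := lowX_lt_BK hK
  have h2 := highX_lt_F φ
  have h3 : BK K * highX φ + BK K ≤ BK K * F φ := by
    rw [← Nat.mul_succ]; exact Nat.mul_le_mul_left _ h2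
  unfold Xt R; omega

/-- `1 ≤ lowX` for `K ≥ 1`. [folklore] -/
theorem one_le_lowX {K : ℕ} (hK : 1 ≤ K) : 1 ≤ lowX K := by
  unfold lowX
  calc 1 = (K + 1) ^ 0 := rfl
    _ ≤ ∑ i ∈ range K, (K + 1) ^ i := single_le_sum (f := fun i => (K + 1) ^ i)
        (fun _ _ => Nat.zero_le _) (mem_range.2 hK)

/-- **The entries are smaller than the dummy in absolute value**: `|y| + 1 < D0`, indeed
`|y| ≤ (K+1)(K R − 1)`. [folklore] -/
theorem natAbs_yval_lt (φ : CNF ℕ) {K i : ℕ} (hi : i < K) (μ : ℕ) :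
    (yval φ K i μ).natAbs + (K + 1) ≤ (K + 1) * K * R φ K := by
  have hK : 1 ≤ K := by omega
  have hv := val_lt_R φ hi μ
  have hX := Xt_lt_R φ hK
  have hX1 : 1 ≤ Xt φ K := le_add_right (one_le_lowX hK)
  have hv1 := one_le_val φ K i μ
  have key : ((K : ℤ) * (val φ K i μ : ℤ) - (Xt φ K : ℤ)).natAbs + 1 ≤ K * R φ K := by
    have hR : K * val φ K i μ + K ≤ K * R φ K := by
      rw [← Nat.mul_succ]; exact Nat.mul_le_mul_left _ hv
    have hKR : R φ K ≤ K * R φ K := Nat.le_mul_of_pos_left _ hK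
    rcases le_or_gt (Xt φ K) (K * val φ K i μ) with h | h
    · rw [show (K : ℤ) * (val φ K i μ : ℤ) - (Xt φ K : ℤ) = ((K * val φ K i μ - Xt φ K : ℕ) : ℤ) by
        push_cast [Nat.cast_sub h]; ring, Int.natAbs_natCast]
      omega
    · rw [show (K : ℤ) * (val φ K i μ : ℤ) - (Xt φ K : ℤ) = -((Xt φ K - K * val φ K i μ : ℕ) : ℤ) by
        push_cast [Nat.cast_sub h.le]; ring, Int.natAbs_neg, Int.natAbs_natCast]
      omega
  unfold yval
  rw [Int.natAbs_mul, Int.natAbs_natCast]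
  calc (K + 1) * ((K : ℤ) * (val φ K i μ : ℤ) - (Xt φ K : ℤ)).natAbs + (K + 1)
      = (K + 1) * (((K : ℤ) * (val φ K i μ : ℤ) - (Xt φ K : ℤ)).natAbs + 1) := by ring
    _ ≤ (K + 1) * (K * R φ K) := Nat.mul_le_mul_left _ key
    _ = (K + 1) * K * R φ K := by ring

/-- `|y| < D0`. [folklore] -/
theorem natAbs_yval_lt_D0 (φ : CNF ℕ) {K i : ℕ} (hi : i < K) (μ : ℕ) :
    (yval φ K i μ).natAbs < D0 φ K := by
  have := natAbs_yval_lt φ hi μ; unfold D0; omega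

/-- `P ≤ N`. [folklore] -/
theorem P_le_N (φ : CNF ℕ) (K : ℕ) : P φ K ≤ N φ K := Nat.le_add_left _ _

/-- `4 ≤ P`, hence `4 ≤ N`. [folklore] -/
theorem four_le_P (φ : CNF ℕ) (K : ℕ) : 4 ≤ P φ K := by
  unfold P
  have h1 : 1 ≤ (K + 1) ^ 2 := Nat.one_le_pow _ _ (by omega)
  have h2 : 1 ≤ 2 ^ bt φ K := Nat.one_le_two_pow
  calc 4 = 4 * 1 * 1 := rfl
    _ ≤ 4 * (K + 1) ^ 2 * 2 ^ bt φ K := Nat.mul_le_mul (Nat.mul_le_mul_left _ h1) h2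

/-- `F ≤ 2^{t K}`: `4^{5m} = 2^{10 m}` and `10 m ≤ t K` (for `K ≥ 1`). [folklore] -/
theorem F_le_two_pow (φ : CNF ℕ) {K : ℕ} (hK : 1 ≤ K) : F φ ≤ (2 ^ bt φ K) ^ K := by
  have h : 10 * φ.length ≤ bt φ K * K := le_blockLen_mul hK
  unfold F
  rw [show (4 : ℕ) = 2 ^ 2 by norm_num, ← Nat.pow_mul, ← Nat.pow_mul]
  exact Nat.pow_le_pow_right (by norm_num) (by omega)

/-- **The dummy is within the range**: `D0 ≤ N^K` (for `K ≥ 2`). [folklore] -/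
theorem D0_le_N_pow (φ : CNF ℕ) {K : ℕ} (hK : 2 ≤ K) : D0 φ K ≤ N φ K ^ K := by
  have hK1 : 1 ≤ K := by omega
  -- `D0 ≤ (K+1)^{K+2} F`
  have h1 : D0 φ K ≤ (K + 1) ^ (K + 2) * F φ := by
    have hBF : 1 ≤ BK K * F φ := Nat.one_le_iff_ne_zero.2 (Nat.mul_ne_zero
      (Nat.one_le_iff_ne_zero.1 (one_le_BK K)) (Nat.one_le_iff_ne_zero.1 (one_le_F φ)))
    have h3 : 1 ≤ (K + 1) * (BK K * F φ) := le_trans hBF (Nat.le_mul_of_pos_left _ (by omega))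
    unfold D0 R
    calc (K + 1) * K * (BK K * F φ) + 1 ≤ (K + 1) * K * (BK K * F φ) + (K + 1) * (BK K * F φ) :=
          Nat.add_le_add_left h3 _
      _ = (K + 1) ^ (K + 2) * F φ := by unfold BK; ring
  -- `(K+1)^{K+2} ≤ (4 (K+1)²)^K`
  have h2 : (K + 1) ^ (K + 2) ≤ (4 * (K + 1) ^ 2) ^ K := by
    calc (K + 1) ^ (K + 2) ≤ (K + 1) ^ (2 * K) := Nat.pow_le_pow_right (by omega) (by omega)
      _ = ((K + 1) ^ 2) ^ K := by rw [← Nat.pow_mul]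
      _ ≤ (4 * (K + 1) ^ 2) ^ K := Nat.pow_le_pow_left (Nat.le_mul_of_pos_left _ (by norm_num)) _
  calc D0 φ K ≤ (K + 1) ^ (K + 2) * F φ := h1
    _ ≤ (4 * (K + 1) ^ 2) ^ K * (2 ^ bt φ K) ^ K := Nat.mul_le_mul h2 (F_le_two_pow φ hK1)
    _ = P φ K ^ K := by unfold P; rw [← Nat.mul_pow]
    _ ≤ N φ K ^ K := Nat.pow_le_pow_left (P_le_N φ K) _

/-- **The range promise**: every entry lies in `[-N^K, N^K]` (`K ≥ 2`). [folklore] -/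
theorem natAbs_entry_le (φ : CNF ℕ) {K : ℕ} (hK : 2 ≤ K) (ι : ℕ) :
    (entry φ K ι).natAbs ≤ N φ K ^ K := by
  have hD := D0_le_N_pow φ hK
  unfold entry
  split_ifs with h
  · have hpos : 0 < nMask φ K := Nat.two_pow_pos _
    have hi : ι / nMask φ K < K := Nat.div_lt_of_lt_mul (by rwa [Nat.mul_comm] at h)
    exact le_trans (natAbs_yval_lt_D0 φ hi _).le hD
  · rw [Int.natAbs_natCast]; exact hD

/-- The list satisfies the range promise of `kSUM K`. [folklore] -/
theorem hasBoundedEntries_ksumList (φ : CNF ℕ) {K : ℕ} (hK : 2 ≤ K) :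
    HasBoundedEntries (ksumList φ K) ((ksumList φ K).length ^ K) := by
  intro z hz
  rw [length_ksumList]
  obtain ⟨ι, hι, rfl⟩ := List.getElem_of_mem hz
  rw [getElem_ksumList, ← Int.natCast_natAbs]
  exact_mod_cast natAbs_entry_le φ hK ι


/-! ### Uniqueness of positional representations -/

/-- **Digits are unique**: two numerals of length `M` in base `B` with digits `< B` and the same
value have the same digits. [folklore] -/
theorem digits_unique {B : ℕ} (c d : ℕ → ℕ) (M : ℕ) (hc : ∀ b, b < M → c b < B)
    (hd : ∀ b, b < M → d b < B)
    (h : ∑ b ∈ range M, c b * B ^ b = ∑ b ∈ range M, d b * B ^ b) : ∀ b, b < M → c b = d b := by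
  induction M generalizing c d with
  | zero => intro b hb; omega
  | succ M ih =>
    intro b hb
    have hB : 0 < B := by have := hc 0 (by omega); omega
    have e : ∀ f : ℕ → ℕ, ∑ i ∈ range (M + 1), f i * B ^ i =
        B * ∑ i ∈ range M, f (i + 1) * B ^ i + f 0 := by
      intro f
      rw [sum_range_succ', pow_zero, mul_one, mul_sum]
      exact congrArg (· + f 0) (sum_congr rfl fun i _ => by rw [pow_succ]; ring)
    rw [e c, e d] at h
    have hc0 := hc 0 (by omega)
    have hd0 := hd 0 (by omega)
    have h0 : c 0 = d 0 := by
      have := congrArg (· % B) h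
      simpa only [Nat.mul_add_mod, Nat.mod_eq_of_lt hc0, Nat.mod_eq_of_lt hd0] using this
    have h1 : ∑ i ∈ range M, c (i + 1) * B ^ i = ∑ i ∈ range M, d (i + 1) * B ^ i := by
      have := congrArg (· / B) h
      simpa only [Nat.mul_add_div hB, Nat.div_eq_of_lt hc0, Nat.div_eq_of_lt hd0, Nat.add_zero] using this
    rcases b with _ | b
    · exact h0
    · exact ih (fun i => c (i + 1)) (fun i => d (i + 1)) (fun i hi => hc _ (by omega))
        (fun i hi => hd _ (by omega)) h1 b (by omega)

/-! ### Block assignments as bit masks -/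

/-- The number whose bits `0, …, len - 1` are `f 0, …, f (len - 1)`. [folklore] -/
def bitsOf (f : ℕ → Bool) : ℕ → ℕ
  | 0 => 0
  | len + 1 => 2 ^ len * (f len).toNat + bitsOf f len

/-- `bitsOf f len < 2^len`. [folklore] -/
theorem bitsOf_lt (f : ℕ → Bool) : ∀ len, bitsOf f len < 2 ^ len
  | 0 => by simp [bitsOf]
  | len + 1 => by
    have h1 := bitsOf_lt f len
    have h2 : 2 ^ len * (f len).toNat ≤ 2 ^ len * 1 := Nat.mul_le_mul_left _ (Bool.toNat_le _)
    rw [bitsOf, pow_succ]; omega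

/-- The bits of `bitsOf`. [folklore] -/
theorem testBit_bitsOf (f : ℕ → Bool) : ∀ len v, (bitsOf f len).testBit v = (decide (v < len) && f v)
  | 0, v => by simp [bitsOf]
  | len + 1, v => by
    rw [bitsOf, Nat.testBit_two_pow_mul_add _ (bitsOf_lt f len)]
    split_ifs with h
    · rw [testBit_bitsOf f len v]; simp [h, Nat.lt_succ_of_lt h]
    · rcases Nat.eq_or_lt_of_le (not_lt.1 h) with rfl | hlt
      · rw [Nat.sub_self]; cases f len <;> simp
      · have : (f len).toNat.testBit (v - len) = false := by
          apply Nat.testBit_lt_two_pow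
          calc (f len).toNat ≤ 1 := Bool.toNat_le _
            _ < 2 ^ (v - len) := Nat.one_lt_two_pow (by omega)
        rw [this]
        have : ¬ v < len + 1 := by omega
        simp [this]

/-- The assignment of the extended variables encoded by a family of block masks `μf` (block size
`s`): variable `v` is bit `v % s` of the mask of block `v / s`. [folklore] -/
def σOf (s : ℕ) (μf : ℕ → ℕ) (v : ℕ) : Bool :=
  (μf (v / s)).testBit (v % s)

/-- The block masks of an assignment: mask `b` has bits `σ (b s), …, σ (b s + s - 1)`. [folklore] -/
def maskOf (σ : ℕ → Bool) (s b : ℕ) : ℕ :=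
  bitsOf (fun v => σ (b * s + v)) s

/-- Masks are block assignments: `maskOf σ s b < 2^s`. [folklore] -/
theorem maskOf_lt (σ : ℕ → Bool) (s b : ℕ) : maskOf σ s b < 2 ^ s := bitsOf_lt _ _

/-- Decoding the masks of `σ` gives back `σ`. [folklore] -/
theorem σOf_maskOf {s : ℕ} (hs : 0 < s) (σ : ℕ → Bool) (v : ℕ) : σOf s (maskOf σ s) v = σ v := by
  unfold σOf maskOf
  rw [testBit_bitsOf]
  simp [Nat.mod_lt _ hs, Nat.div_add_mod']

/-- If some gadget position exists then the block size is positive. [folklore] -/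
theorem bs_pos {φ : CNF ℕ} {K : ℕ} (hK : 0 < K) {v : ℕ} (hv : v < nAll φ) : 0 < bs φ K := by
  have := le_blockLen_mul (m := nAll φ) hK
  unfold bs
  rcases Nat.eq_zero_or_pos (blockLen (nAll φ) K) with h | h
  · rw [h] at this; omega
  · exact h

/-- **The digits of a one-per-block selection, position by position**: summed over the blocks,
the bit of position `(j, e)` under the masks `μf` is the value of the position under the decoded
assignment `σOf s μf`. [folklore] -/
theorem sum_posBit (φ : CNF ℕ) {K : ℕ} (hK : 0 < K) (μf : ℕ → ℕ) {j : ℕ} (hj : j < 5 * φ.length)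
    (e : ℕ) :
    ∑ b ∈ range K, (posBit φ (bs φ K) b (μf b) j e).toNat = posVal φ (σOf (bs φ K) μf) j e := by
  unfold posBit posVal
  cases hl : posLit φ j e with
  | none => simp
  | some lit =>
    simp only
    set s := bs φ K with hsdef
    have hv : lit.1 < nAll φ := posLit_fst_lt hj hl
    have hs : 0 < s := bs_pos hK hv
    have hsK : nAll φ ≤ s * K := le_blockLen_mul hK
    have hb : lit.1 / s < K := Nat.div_lt_of_lt_mul (lt_of_lt_of_le hv hsK)
    have h1 : lit.1 / s * s ≤ lit.1 := Nat.div_mul_le_self _ _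
    have h2 : lit.1 < lit.1 / s * s + s := Nat.lt_div_mul_add hs
    have h3 : lit.1 - lit.1 / s * s = lit.1 % s := by
      have := Nat.div_add_mod' lit.1 s; omega
    rw [sum_eq_single (lit.1 / s)]
    · simp [h1, h2, h3, σOf]
    · intro b _ hne
      have : ¬ (b * s ≤ lit.1 ∧ lit.1 < b * s + s) := fun ⟨h4, h5⟩ =>
        hne (Nat.div_eq_of_lt_le h4 (by rw [Nat.add_mul, Nat.one_mul]; exact h5)).symm
      rcases not_and_or.1 this with h4 | h4 <;> simp [h4]
    · intro hmem; exact absurd (mem_range.2 hb) hmem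

/-- The constraint digits of a one-per-block selection are the constraint sums of the decoded
assignment. [folklore] -/
theorem sum_cnt (φ : CNF ℕ) {K : ℕ} (hK : 0 < K) (μf : ℕ → ℕ) {j : ℕ} (hj : j < 5 * φ.length) :
    ∑ b ∈ range K, cnt φ (bs φ K) b (μf b) j = conSum φ (σOf (bs φ K) μf) j := by
  unfold cnt conSum
  rw [sum_add_distrib, sum_add_distrib, sum_posBit φ hK μf hj, sum_posBit φ hK μf hj,
    sum_posBit φ hK μf hj]

/-- The constraint parts of a one-per-block selection, summed: `∑_b high = ∑_j conSum_j 4^j`.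
[folklore] -/
theorem sum_high_eq (φ : CNF ℕ) {K : ℕ} (hK : 0 < K) (μf : ℕ → ℕ) :
    ∑ b ∈ range K, high φ K b (μf b) =
      ∑ j ∈ range (5 * φ.length), conSum φ (σOf (bs φ K) μf) j * 4 ^ j := by
  unfold high
  rw [sum_comm]
  refine sum_congr rfl fun j hj => ?_
  rw [← sum_mul, sum_cnt φ hK μf (mem_range.1 hj)]

/-- A position value is a bit. [folklore] -/
theorem posVal_le (φ : CNF ℕ) (σ : ℕ → Bool) (j e : ℕ) : posVal φ σ j e ≤ 1 := by
  unfold posVal; split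
  · exact Bool.toNat_le _
  · exact Nat.zero_le _

/-- A constraint sum is at most `3`. [folklore] -/
theorem conSum_le (φ : CNF ℕ) (σ : ℕ → Bool) (j : ℕ) : conSum φ σ j ≤ 3 := by
  have h0 := posVal_le φ σ j 0; have h1 := posVal_le φ σ j 1; have h2 := posVal_le φ σ j 2
  unfold conSum; omega

/-- The entry of the pair `(b, μ)`. [folklore] -/
theorem entry_pair (φ : CNF ℕ) {K b μ : ℕ} (hb : b < K) (hμ : μ < nMask φ K) :
    entry φ K (nMask φ K * b + μ) = yval φ K b μ := by
  have hpos : 0 < nMask φ K := Nat.two_pow_pos _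
  have hlt : nMask φ K * b + μ < K * nMask φ K := by
    have : nMask φ K * (b + 1) ≤ nMask φ K * K := Nat.mul_le_mul_left _ hb
    rw [Nat.mul_comm K]; rw [Nat.mul_succ] at this; omega
  unfold entry
  rw [if_pos hlt, Nat.mul_add_div hpos, Nat.div_eq_of_lt hμ, Nat.add_zero, Nat.mul_add_mod,
    Nat.mod_eq_of_lt hμ]

/-! ### The equivalence -/

/-- **Completeness of the reduction**: a satisfiable width-`≤ 3` clause list yields `K` entries at
distinct positions summing to `0` — the numbers of the blocks of (the gadget extension of) a
satisfying assignment. [cite: PatrascuWilliams2010, proof of Thm. 5.1] -/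
theorem hasKSum_of_satisfiable (φ : CNF ℕ) {K : ℕ} (hK : 1 ≤ K) (hw : φ.IsWidthLE 3)
    (hsat : φ.Satisfiable) : HasKSum K (ksumList φ K) := by
  classical
  obtain ⟨σ₀, hσ₀⟩ := hsat
  set σ := extend φ σ₀ with hσdef
  have hcon : ∀ j, j < 5 * φ.length → conSum φ σ j = 1 := forall_conSum_extend hw hσ₀
  set s := bs φ K with hsdef
  set μf : ℕ → ℕ := maskOf σ s with hμfdef
  -- every constraint digit sums to `1`
  have hT : ∀ j, j < 5 * φ.length → conSum φ (σOf s μf) j = 1 := by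
    intro j hj
    rw [← hcon j hj]
    exact conSum_congr (fun v hv => σOf_maskOf (bs_pos hK hv) σ v) hj
  -- the constraint parts sum to `highX`, the numbers to `X`, the entries to `0`
  have hH : ∑ b ∈ range K, high φ K b (μf b) = highX φ := by
    rw [sum_high_eq φ hK μf]
    exact sum_congr rfl fun j hj => by rw [hT j (mem_range.1 hj), one_mul]
  have hV : ∑ b ∈ range K, val φ K b (μf b) = Xt φ K := by
    unfold val Xt lowX; rw [sum_add_distrib, ← mul_sum, hH]
  have hY : ∑ b ∈ range K, yval φ K b (μf b) = 0 := by
    have hV' : ∑ b ∈ range K, (val φ K b (μf b) : ℤ) = (Xt φ K : ℤ) := by exact_mod_cast hV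
    unfold yval
    rw [← mul_sum, sum_sub_distrib, ← mul_sum, hV', sum_const, card_range, nsmul_eq_mul]
    ring
  -- the index set
  have hμ : ∀ b, μf b < nMask φ K := fun b => maskOf_lt σ s b
  have hidx : ∀ b, b < K → nMask φ K * b + μf b < (ksumList φ K).length := fun b hb => by
    rw [length_ksumList]; unfold N
    have : nMask φ K * (b + 1) ≤ nMask φ K * K := Nat.mul_le_mul_left _ hb
    have := hμ b
    rw [Nat.mul_succ] at *; rw [Nat.mul_comm K]; omega
  let f : Fin K → Fin (ksumList φ K).length := fun b => ⟨nMask φ K * b + μf b, hidx b b.2⟩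
  have hpos : 0 < nMask φ K := Nat.two_pow_pos _
  have hf : Function.Injective f := by
    intro b₁ b₂ h
    have h' : nMask φ K * b₁ + μf b₁ = nMask φ K * b₂ + μf b₂ := congrArg Fin.val h
    have e : ∀ b : Fin K, (nMask φ K * b + μf b) / nMask φ K = b := fun b => by
      rw [Nat.mul_add_div hpos, Nat.div_eq_of_lt (hμ _), Nat.add_zero]
    exact Fin.ext (by rw [← e b₁, ← e b₂, h'])
  refine ⟨Finset.univ.map ⟨f, hf⟩, by simp, ?_⟩
  rw [sum_map]
  have hterm : ∀ b : Fin K, (ksumList φ K).get ((⟨f, hf⟩ : Fin K ↪ _) b) = yval φ K b (μf b) := by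
    intro b
    show (ksumList φ K).get (f b) = _
    rw [List.get_eq_getElem]
    show (ksumList φ K)[nMask φ K * b + μf b]'(hidx b b.2) = _
    rw [getElem_ksumList, entry_pair φ b.2 (hμ b)]
  rw [sum_congr rfl fun b _ => hterm b, Fin.sum_univ_eq_sum_range (fun b => yval φ K b (μf b)) K]
  exact hY

/-- **Soundness of the reduction**: if `K ≥ 2` entries of the list at distinct positions sum to
`0`, then `φ` is satisfiable. No dummy takes part (modulo `K + 1` the sum is the number of
dummies), the numbers sum to the target, the indicator digits force one number per block and the
constraint digits force every constraint to be satisfied exactly once by the decoded assignment.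
[cite: PatrascuWilliams2010, proof of Thm. 5.1] -/
theorem satisfiable_of_hasKSum (φ : CNF ℕ) {K : ℕ} (hK : 2 ≤ K) (h : HasKSum K (ksumList φ K)) :
    φ.Satisfiable := by
  classical
  obtain ⟨S, hcard, hsum⟩ := h
  have hK0 : 0 < K := by omega
  set nM := nMask φ K with hnM
  have hnM0 : 0 < nM := Nat.two_pow_pos _
  set s := bs φ K with hsdef
  have hget : ∀ ι : Fin (ksumList φ K).length, (ksumList φ K).get ι = entry φ K ι := fun ι => by
    rw [List.get_eq_getElem, getElem_ksumList]
  simp only [hget] at hsum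
  -- Step 1: no dummy is selected
  have hdecomp : ∀ ι : Fin (ksumList φ K).length, entry φ K ι =
      ((K : ℤ) + 1) * (if (ι : ℕ) < K * nM then (K : ℤ) * val φ K (ι / nM) (ι % nM) - Xt φ K
        else (K : ℤ) * R φ K) + (if ¬ (ι : ℕ) < K * nM then 1 else 0) := by
    intro ι
    unfold entry
    by_cases hl : (ι : ℕ) < K * nM
    · rw [if_pos hl, if_pos hl, if_neg (not_not.2 hl)]; unfold yval; push_cast; ring
    · rw [if_neg hl, if_neg hl, if_pos hl]; unfold D0; push_cast; ring
  set d := (S.filter fun ι : Fin (ksumList φ K).length => ¬ (ι : ℕ) < K * nM).card with hddef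
  have hd0 : d = 0 := by
    have hdK : d ≤ K := (card_filter_le _ _).trans hcard.le
    set Q := ∑ ι ∈ S, (if (ι : ℕ) < K * nM then (K : ℤ) * val φ K (ι / nM) (ι % nM) - Xt φ K
        else (K : ℤ) * R φ K) with hQ
    have hsum' : ((K : ℤ) + 1) * Q + (d : ℤ) = 0 := by
      rw [← hsum, sum_congr rfl (fun ι _ => hdecomp ι), sum_add_distrib, mul_sum, hddef]
      congr 1
      rw [sum_boole]
    have hdvd : (K + 1) ∣ d := by
      have : ((K + 1 : ℕ) : ℤ) ∣ (d : ℤ) := ⟨-Q, by push_cast; linarith⟩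
      exact_mod_cast this
    exact Nat.eq_zero_of_dvd_of_lt hdvd (by omega)
  have hleg : ∀ ι ∈ S, (ι : ℕ) < K * nM := by
    have := filter_eq_empty_iff.1 (card_eq_zero.1 hd0)
    exact fun ι hι => not_not.1 (this hι)
  -- Step 2: the numbers sum to the target
  have hiK : ∀ ι ∈ S, (ι : ℕ) / nM < K := fun ι hι =>
    Nat.div_lt_of_lt_mul (by rw [Nat.mul_comm]; exact hleg ι hι)
  have hV : ∑ ι ∈ S, val φ K (ι / nM) (ι % nM) = Xt φ K := by
    have h1 : ∑ ι ∈ S, yval φ K (ι / nM) (ι % nM) = 0 := by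
      rw [← hsum]
      exact sum_congr rfl fun ι hι => by unfold entry; rw [if_pos (hleg ι hι)]
    unfold yval at h1
    rw [← mul_sum, sum_sub_distrib, ← mul_sum, sum_const, hcard, nsmul_eq_mul] at h1
    have hK1 : ((K + 1 : ℕ) : ℤ) ≠ 0 := by positivity
    have h2 := (mul_eq_zero.1 h1).resolve_left hK1
    rw [sub_eq_zero, ← Nat.cast_sum] at h2
    have hK' : (K : ℤ) ≠ 0 := by exact_mod_cast hK0.ne'
    exact_mod_cast mul_left_cancel₀ hK' h2
  -- Step 3: indicator part and constraint part separately
  set low := ∑ ι ∈ S, (K + 1) ^ ((ι : ℕ) / nM) with hlowdef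
  set H := ∑ ι ∈ S, high φ K (ι / nM) (ι % nM) with hHdef
  have hsplit : low + BK K * H = lowX K + BK K * highX φ := by
    have : ∑ ι ∈ S, val φ K (ι / nM) (ι % nM) = low + BK K * H := by
      unfold val; rw [sum_add_distrib, ← mul_sum]
    rw [← this, hV]; rfl
  have hlow : low < BK K := by
    calc low ≤ ∑ ι ∈ S, (K + 1) ^ (K - 1) :=
          sum_le_sum fun ι hι => Nat.pow_le_pow_right (by omega) (by have := hiK ι hι; omega)
      _ = K * (K + 1) ^ (K - 1) := by rw [sum_const, hcard, smul_eq_mul]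
      _ < (K + 1) * (K + 1) ^ (K - 1) := Nat.mul_lt_mul_of_pos_right (by omega) (by positivity)
      _ = BK K := by unfold BK; rw [← pow_succ']; congr 1; omega
  have hlowX : lowX K < BK K := lowX_lt_BK (by omega)
  have hBK : 0 < BK K := one_le_BK K
  have e1 : low = lowX K := by
    have := congrArg (· % BK K) hsplit
    simpa only [Nat.add_mul_mod_self_left, Nat.mod_eq_of_lt hlow, Nat.mod_eq_of_lt hlowX] using this
  have e2 : H = highX φ := by
    have := congrArg (· / BK K) hsplit
    simpa only [Nat.add_mul_div_left _ _ hBK, Nat.div_eq_of_lt hlow, Nat.div_eq_of_lt hlowX,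
      Nat.zero_add] using this
  -- Step 4: one number from each block
  set c : ℕ → ℕ := fun b => (S.filter fun ι : Fin (ksumList φ K).length => (ι : ℕ) / nM = b).card
    with hcdef
  have hfib : ∑ b ∈ range K, c b * (K + 1) ^ b = low := by
    rw [hlowdef, ← sum_fiberwise_of_maps_to (g := fun ι : Fin (ksumList φ K).length => (ι : ℕ) / nM)
      (t := range K) (fun ι hι => mem_range.2 (hiK ι hι))]
    refine sum_congr rfl fun b _ => ?_
    rw [sum_congr rfl (fun ι hι => by rw [(mem_filter.1 hι).2] :
      ∀ ι ∈ S.filter (fun ι : Fin (ksumList φ K).length => (ι : ℕ) / nM = b),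
        (K + 1) ^ ((ι : ℕ) / nM) = (K + 1) ^ b),
      sum_const, smul_eq_mul]
  have hc1 : ∀ b, b < K → c b = 1 := by
    refine digits_unique (B := K + 1) c (fun _ => 1) K
      (fun b _ => Nat.lt_succ_of_le ((card_filter_le _ _).trans hcard.le)) (fun b _ => by omega) ?_
    rw [hfib, e1]; unfold lowX; simp
  -- Step 5: the selected mask of each block
  have hsing : ∀ b, b < K → ∃ a, S.filter (fun ι : Fin (ksumList φ K).length => (ι : ℕ) / nM = b) =
      {a} := fun b hb =>
    card_eq_one.1 (hc1 b hb)
  let μf : ℕ → ℕ := fun b => if hb : b < K then (Classical.choose (hsing b hb)).val % nM else 0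
  have hH : H = ∑ b ∈ range K, high φ K b (μf b) := by
    rw [hHdef, ← sum_fiberwise_of_maps_to (g := fun ι : Fin (ksumList φ K).length => (ι : ℕ) / nM)
      (t := range K) (fun ι hι => mem_range.2 (hiK ι hι))]
    refine sum_congr rfl fun b hb => ?_
    have hb' := mem_range.1 hb
    have ha := Classical.choose_spec (hsing b hb')
    rw [ha, sum_singleton]
    have hmem : Classical.choose (hsing b hb') ∈
        S.filter (fun ι : Fin (ksumList φ K).length => (ι : ℕ) / nM = b) := by
      have h := mem_singleton_self (Classical.choose (hsing b hb'))
      rwa [← ha] at h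
    rw [(mem_filter.1 hmem).2]
    simp only [μf, dif_pos hb']
  -- Step 6: every constraint digit is `1`, so the decoded assignment satisfies the gadget formula
  have hT : ∀ j, j < 5 * φ.length → conSum φ (σOf s μf) j = 1 := by
    refine digits_unique (B := 4) (fun j => conSum φ (σOf s μf) j) (fun _ => 1) (5 * φ.length)
      (fun j _ => Nat.lt_succ_of_le (conSum_le φ _ j)) (fun _ _ => by norm_num) ?_
    rw [← sum_high_eq φ hK0 μf, ← hH, e2]; unfold highX; simp
  exact ⟨σOf s μf, eval_of_forall_conSum hT⟩

/-- **The reduction is correct**: for `K ≥ 2` and a clause list of width `≤ 3`, the `K`-SUM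
instance `ksumList φ K` has `K` entries at distinct positions summing to `0` iff `φ` is
satisfiable. (Pătraşcu–Williams 2010, proof of Thm. 5.1: "a `d`-sum exists if and only if the
1-in-3 SAT formula is satisfiable", composed with Schaefer's gadget.)
[cite: PatrascuWilliams2010, proof of Thm. 5.1] -/
theorem hasKSum_ksumList_iff {φ : CNF ℕ} {K : ℕ} (hK : 2 ≤ K) (hw : φ.IsWidthLE 3) :
    HasKSum K (ksumList φ K) ↔ φ.Satisfiable :=
  ⟨satisfiable_of_hasKSum φ hK, hasKSum_of_satisfiable φ (by omega) hw⟩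


/-! ### The word encoding of the instance -/

/-- The zig-zag code of the entry of `(i, μ)`, in natural-number arithmetic (as computed by the
reduction program). [folklore] -/
def ycode (φ : CNF ℕ) (K i μ : ℕ) : ℕ :=
  if Xt φ K ≤ K * val φ K i μ then 2 * ((K + 1) * (K * val φ K i μ - Xt φ K))
  else 2 * ((K + 1) * (Xt φ K - K * val φ K i μ)) - 1

/-- `encodeInt (yval …) = ycode …`. [folklore] -/
theorem encodeInt_yval (φ : CNF ℕ) (K i μ : ℕ) : encodeInt (yval φ K i μ) = ycode φ K i μ := by
  unfold ycode yval
  split_ifs with h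
  · have : ((K + 1 : ℕ) : ℤ) * ((K : ℤ) * (val φ K i μ : ℤ) - (Xt φ K : ℤ)) =
        (((K + 1) * (K * val φ K i μ - Xt φ K) : ℕ) : ℤ) := by
      push_cast [Nat.cast_sub h]; ring
    rw [this, encodeInt_natCast]
  · have h' : K * val φ K i μ < Xt φ K := not_le.1 h
    have hpos : 1 ≤ (K + 1) * (Xt φ K - K * val φ K i μ) := Nat.mul_pos (Nat.succ_pos _) (by omega)
    have : ((K + 1 : ℕ) : ℤ) * ((K : ℤ) * (val φ K i μ : ℤ) - (Xt φ K : ℤ)) =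
        Int.negSucc ((K + 1) * (Xt φ K - K * val φ K i μ) - 1) := by
      rw [Int.negSucc_eq]
      push_cast [Nat.cast_sub h'.le, Nat.cast_sub hpos]
      ring
    rw [this, encodeInt_negSucc]; omega

/-- The codes of the entries are at most `2 D0`, the code of the dummy. [folklore] -/
theorem encodeInt_entry_le (φ : CNF ℕ) (K ι : ℕ) : encodeInt (entry φ K ι) ≤ 2 * D0 φ K := by
  unfold entry
  split_ifs with h
  · have hi : ι / nMask φ K < K := Nat.div_lt_of_lt_mul (by rwa [Nat.mul_comm] at h)
    exact (encodeInt_le_two_mul_natAbs _).trans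
      (Nat.mul_le_mul_left _ (natAbs_yval_lt_D0 φ hi _).le)
  · rw [encodeInt_natCast]

/-- **The input width of the instance**: the largest word of `encodeIntList (ksumList φ K)` is
the dummy code `2 D0` (by `encodeInt_le_two_mul_natAbs` of `SubcubicEquivalencesAPSP.lean`), so
the width is `size (max N (2 D0))`. [folklore] -/
theorem inputWidth_ksumList (φ : CNF ℕ) (K : ℕ) :
    WordRAM.inputWidth (encodeIntList (ksumList φ K)) = Nat.size (max (N φ K) (2 * D0 φ K)) := by
  unfold WordRAM.inputWidth
  rw [encodeIntList_length, length_ksumList]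
  congr 1
  congr 1
  apply le_antisymm
  · refine foldr_max_one_le (by unfold D0; omega) fun v hv => ?_
    obtain ⟨z, hz, rfl⟩ := List.mem_map.1 hv
    obtain ⟨ι, hι, rfl⟩ := List.getElem_of_mem hz
    rw [getElem_ksumList]
    exact encodeInt_entry_le φ K ι
  · apply CliqueRed.le_foldr_max_of_mem
    refine List.mem_map.2 ⟨(D0 φ K : ℤ), ?_, encodeInt_natCast _⟩
    have hidx : K * nMask φ K < (ksumList φ K).length := by
      rw [length_ksumList]; unfold N; have := four_le_P φ K; omega
    have : (ksumList φ K)[K * nMask φ K] = (D0 φ K : ℤ) := by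
      rw [getElem_ksumList]; unfold entry; rw [if_neg (lt_irrefl _)]
    rw [← this]
    exact List.getElem_mem hidx

/-! ### The `kSUM K` instance -/

/-- **The `kSUM K` instance of the reduction** (the list with its range promise, `K ≥ 2`).
[cite: PatrascuWilliams2010, proof of Thm. 5.1] -/
def ksumInst (φ : CNF ℕ) {K : ℕ} (hK : 2 ≤ K) : (kSUM K).Inst :=
  ⟨ksumList φ K, hasBoundedEntries_ksumList φ hK⟩

/-- The encoding of the instance. [folklore] -/
theorem kSUM_encode_ksumInst (φ : CNF ℕ) {K : ℕ} (hK : 2 ≤ K) :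
    (kSUM K).encode (ksumInst φ hK) = encodeIntList (ksumList φ K) := rfl

/-- The size of the instance is `N`. [folklore] -/
theorem kSUM_size_ksumInst (φ : CNF ℕ) {K : ℕ} (hK : 2 ≤ K) :
    (kSUM K).size (ksumInst φ hK) = N φ K := length_ksumList φ K

/-- The input width of the instance. [folklore] -/
theorem kSUM_width_ksumInst (φ : CNF ℕ) {K : ℕ} (hK : 2 ≤ K) :
    (kSUM K).width (ksumInst φ hK) = Nat.size (max (N φ K) (2 * D0 φ K)) := inputWidth_ksumList φ K

open scoped Classical in
/-- **The accepted output on the instance**: `[1]` iff `φ` is satisfiable (`K ≥ 2`, width `≤ 3`).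
[cite: PatrascuWilliams2010, proof of Thm. 5.1] -/
theorem kSUM_good_ksumInst {φ : CNF ℕ} {K : ℕ} (hK : 2 ≤ K) (hw : φ.IsWidthLE 3) (out : List ℕ) :
    out ∈ (kSUM K).Good (ksumInst φ hK) ↔ out = [if φ.Satisfiable then 1 else 0] := by
  change out ∈ (FGProblem.ofPred encodeIntList List.length (HasKSum K)).Good (ksumList φ K) ↔ _
  have hiff := hasKSum_ksumList_iff (φ := φ) hK hw
  by_cases h : φ.Satisfiable
  · have h' : HasKSum K (ksumList φ K) := hiff.2 h
    simp [h, h']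
  · have h' : ¬ HasKSum K (ksumList φ K) := fun h'' => h (hiff.1 h'')
    simp [h, h']

end KSumRed

end Literature.Computability.FineGrained
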